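import Summits.Ventures.QEC.Thresholds.ToricCodeThresholdUnconditional
import Summits.Ventures.QEC.Thresholds.ToricCodeExponentialDecay
import Summits.Ventures.QEC.Thresholds.ToricCodePhenomenologicalUnconditional
import Summits.Ventures.QEC.Thresholds.ToricCodeLossThresholds
import Literature.Probability.RandomPlanarGeometry.SAWFiniteMemoryFour
import HarnessLib

/-!
# Toric-code thresholds from the EXACT Fisher–Sykes memory-4 connective-constant bounds
# (`μ(ℤ²) ≤ 2.832`, `μ(ℤ³) ≤ 4.865`): KERNEL decimals `p_c > .0322` (perfect measurement) and
# `p_c > .0106` (noisy measurement), unconditional (LADDER-QEC Q5, certified column)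

Venture QEC, `Summits/Ventures/QEC/Thresholds/`. The unconditional threshold theorems of
`ToricCodeThresholdUnconditional.lean` (qec-type-09; Dennis–Kitaev–Landahl–Preskill route, proved by
qec-lit-2) and `ToricCodePhenomenologicalUnconditional.lean` (qec-type-03) turn ANY proved bound
`μ(ℤ^d) ≤ μ'` on the connective constant into the threshold lower bound
`p₀(μ') = (1 - √(1 - μ'⁻²))/2` (`toricThreshold_connectiveConstant_le`, `d = 2`;
`phenomThreshold_connectiveConstant_three_le`, `d = 3`). The best bounds with STANDARD axioms in the
tree are the exact memory-4 ("no immediate reversal, no unit square") constants of Fisher–Sykes: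
`μ(ℤ^d) ≤ μ₄(d)`, the largest root of `θ³ = 2(d-1)θ² + 2(d-1)θ + 1`
(`Literature/Probability/RandomPlanarGeometry/`: `SAW.Zd.connectiveConstant_le_memoryConstant`
in `SAWFiniteMemoryLimit.lean`, `SAW.Zd.MemFour.memoryConstant_four_lt_of_pos` in `SAWFiniteMemoryFour.lean`;
Madras–Slade (1.2.14): `μ₄(2) = 2.8312`, `μ₄(3) = 4.8645`). This theorem-only file records:

| theorem | statement | tier |
|---|---|---|
| `connectiveConstant_two_lt_2832` / `_le_2832` | `μ(ℤ²) < 2.832` | kernel (sign of the Fisher–Sykes cubic at `2.832`) |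
| `connectiveConstant_three_le_4865` | `μ(ℤ³) ≤ 4.865` | kernel |
| `toricThreshold_fisherSykes` | perfect measurement: threshold `≥ p₀(2.832)` for every min-weight decoder family | CERTIFIED (kernel), unconditional |
| `thresholdValue_2832_bounds` | `.0322 < p₀(2.832) < .0323` | kernel arithmetic |
| `toricThreshold_0322`, `accuracyThreshold_gt_0322`, `hasThreshold_toric_0322`, `ToricCode.accuracyThreshold_minWeight_gt_0322` | **`p_c > .0322`** (was `.0293` from `26^{1/3}`) | CERTIFIED (kernel), unconditional |
| `toric_decaysExponentially_fisherSykes` / `_0322` | exponential decay in `L` below `p₀(2.832)` / at `p ≤ .0322` | CERTIFIED (kernel), unconditional |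
| `phenomThreshold_fisherSykes_three` | noisy measurement (`q = p`): threshold `≥ p₀(4.865)` — agrees with `phenomThreshold_memFour` | CERTIFIED (kernel), unconditional |
| `lossThreshold_fisherSykes`, `loss_accuracyThreshold_gt_0353`, `lossDecoderThreshold_fisherSykes` | LOSS (erasure) channel (qec-lit-2's `ToricCodeLossThresholds.lean`): `y_c ≥ 1/2.832 > .3531` (was `26^{-1/3} > .3373`) | CERTIFIED (kernel), unconditional |

The CHECKED-native (`μ(ℤ²) ≤ 2.688`: `.0358`) and CONDITIONAL (`μ(ℤ²) ≤ 2.679193`, BDGS fact: `.0361`)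
values of the 2D file are untouched and remain the better decimals at their tiers; `.0322` is the
best decimal with axioms `propext`/`Classical.choice`/`Quot.sound` only. NOT A THEOREM ANYWHERE: the
printed `.0373` / `.0114` (numerical `μ₂ ≈ 2.638`, `μ₃ ≈ 4.684`; CLAIM). No definitions, no named facts.

## References

* [DennisEtAl2002] E. Dennis, A. Kitaev, A. Landahl, J. Preskill, J. Math. Phys. 43 (2002) 4452,
  arXiv:quant-ph/0110143, §5.3 eqs. (saw_d), (saw_2), (saw_3), (threshold_2d)–(p_c_2d), (threshold_iso_num).
* [MadrasSlade1993] N. Madras, G. Slade, *The Self-Avoiding Walk*, Birkhäuser 1993, §1.2 eqs.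
  (1.2.12)–(1.2.14) (`μ ≤ μ_τ`; `μ₄(2) = 2.8312`, `μ₄(3) = 4.8645`).
* [FisherSykes1959] M. E. Fisher, M. F. Sykes, Phys. Rev. 114 (1959) 45, Appendix A (A.6), (A.9).
-/

noncomputable section

namespace Summit.Ventures.QEC.Thresholds

open Filter Topology Finset
open Literature.InformationTheory.QuantumCodes
open Literature.InformationTheory.QuantumCodes.ToricCode
open Literature.Probability.RandomPlanarGeometry

/-! ### The kernel connective-constant bounds -/

/-- **`μ(ℤ²) < 2.832`** with standard axioms: `μ ≤ μ₄(2)` (a self-avoiding walk has memory 4) and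
`μ₄(2) < 2.832` since the Fisher–Sykes cubic `θ³ - 2θ² - 2θ - 1` is positive at `2.832`
(`μ₄(2) = 2.8312`). [cite: MadrasSlade1993, §1.2 eqs. (1.2.12), (1.2.14)] -/
theorem connectiveConstant_two_lt_2832 : SAW.Zd.connectiveConstant 2 < 2.832 := by
  haveI : NeZero (2 : ℕ) := ⟨by norm_num⟩
  have h1 := SAW.Zd.connectiveConstant_le_memoryConstant 2 4
  have h2 : SAW.Zd.memoryConstant 2 4 < 2.832 :=
    SAW.Zd.MemFour.memoryConstant_four_lt_of_pos 2 (by norm_num) (by norm_num [SAW.Zd.MemFour.fsCubic])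
  exact lt_of_le_of_lt h1 h2

/-- `μ(ℤ²) ≤ 2.832` (the non-strict form consumed by `toricThreshold_connectiveConstant_le`).
[cite: MadrasSlade1993, §1.2 eqs. (1.2.12), (1.2.14)] -/
theorem connectiveConstant_two_le_2832 : SAW.Zd.connectiveConstant 2 ≤ 2.832 :=
  connectiveConstant_two_lt_2832.le

/-- **`μ(ℤ³) ≤ 4.865`** with standard axioms: `μ ≤ μ₄(3) < 4.865` (the Fisher–Sykes cubic
`θ³ - 4θ² - 4θ - 1` is positive at `4.865`; `μ₄(3) = 4.8645`). [cite: MadrasSlade1993, §1.2 eqs. (1.2.12), (1.2.14)] -/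
theorem connectiveConstant_three_le_4865 : SAW.Zd.connectiveConstant 3 ≤ 4.865 := by
  haveI : NeZero (3 : ℕ) := ⟨by norm_num⟩
  have h1 := SAW.Zd.connectiveConstant_le_memoryConstant 3 4
  have h2 : SAW.Zd.memoryConstant 3 4 < 4.865 :=
    SAW.Zd.MemFour.memoryConstant_four_lt_of_pos 3 (by norm_num) (by norm_num [SAW.Zd.MemFour.fsCubic])
  linarith

/-! ### Perfect syndrome measurement: `p_c > .0322` (kernel, unconditional) -/

/-- **Toric-code threshold `≥ p₀(2.832)`, UNCONDITIONAL, tier CERTIFIED (kernel)**: for every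
minimum-weight decoder family of the toric codes under independent bit-flip noise with perfect
syndrome measurement (the exact memory-4 constant in place of the block bound `26^{1/3} ≈ 2.962`).
[cite: DennisEtAl2002, §5.3 eqs. (saw_2), (threshold_2d)] -/
theorem toricThreshold_fisherSykes {D : (L : ℕ) → ZDecoder (L + 1)}
    (hD : ∀ L, (D L).IsMinWeight (syn (L + 1)) (cycles (L + 1)) hammingNorm) :
    IsThresholdLowerBound (toricFailureFamily D) (thresholdValue 2.832) :=
  toricThreshold_connectiveConstant_le (by norm_num) connectiveConstant_two_le_2832 hD

/-- Decimal certificate: `.0322 < p₀(2.832) < .0323`. [cite: DennisEtAl2002, §5.3 eq. (p_c_2d)] -/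
theorem thresholdValue_2832_bounds :
    (0.0322 : ℝ) < thresholdValue 2.832 ∧ thresholdValue 2.832 < 0.0323 := by
  unfold thresholdValue
  constructor
  · have : Real.sqrt (1 - 1 / (2.832 : ℝ) ^ 2) < 0.9356 := by
      rw [Real.sqrt_lt' (by norm_num)]
      norm_num
    linarith
  · have : (0.9354 : ℝ) < Real.sqrt (1 - 1 / (2.832 : ℝ) ^ 2) := by
      rw [Real.lt_sqrt (by norm_num)]
      norm_num
    linarith

/-- Decimal form: **every `0 ≤ p < .0322` is below threshold** for every minimum-weight decoder
family of the toric codes (perfect measurement) — UNCONDITIONAL, tier CERTIFIED (kernel).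
[cite: DennisEtAl2002, §4.3 (below threshold) and §5.3 eq. (threshold_2d)] -/
theorem toricThreshold_0322 {D : (L : ℕ) → ZDecoder (L + 1)}
    (hD : ∀ L, (D L).IsMinWeight (syn (L + 1)) (cycles (L + 1)) hammingNorm) :
    IsThresholdLowerBound (toricFailureFamily D) 0.0322 :=
  (toricThreshold_fisherSykes hD).anti thresholdValue_2832_bounds.1.le

/-- **`p_c > .0322`** for every minimum-weight decoder family of the toric codes under independent
bit-flip noise with perfect syndrome measurement — UNCONDITIONAL, tier CERTIFIED (kernel); the
previous kernel decimal was `.0293`. [cite: DennisEtAl2002, §5.3 eq. (p_c_2d)] -/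
theorem accuracyThreshold_gt_0322 {D : (L : ℕ) → ZDecoder (L + 1)}
    (hD : ∀ L, (D L).IsMinWeight (syn (L + 1)) (cycles (L + 1)) hammingNorm) :
    (0.0322 : ℝ) < accuracyThreshold (toricFailureFamily D) :=
  lt_of_lt_of_le thresholdValue_2832_bounds.1
    (le_accuracyThreshold (toricThreshold_fisherSykes hD) ((thresholdValue_le_half _).trans (by norm_num)))

/-- The canonical minimum-weight decoders `Decoder.minWeight`: `p_c > .0322` — UNCONDITIONAL,
tier CERTIFIED (kernel). [cite: DennisEtAl2002, §5.3 eq. (p_c_2d)] -/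
theorem ToricCode.accuracyThreshold_minWeight_gt_0322 :
    (0.0322 : ℝ) < accuracyThreshold
      (toricFailureFamily fun L => Decoder.minWeight (syn (L + 1)) hammingNorm) :=
  accuracyThreshold_gt_0322 fun L => ToricCode.isMinWeight_minWeight (L + 1)

/-- `HasThreshold` (PARTITION row-09 vocabulary, `PMF`-valued logical failure probability under
i.i.d. bit flips) at `p₀(2.832) > .0322` for every minimum-weight decoder family — UNCONDITIONAL,
tier CERTIFIED (kernel). [cite: DennisEtAl2002, §4.3 and §5.3 eq. (threshold_2d)] -/
theorem hasThreshold_toric_fisherSykes {D : (L : ℕ) → ZDecoder (L + 1)}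
    (hD : ∀ L, (D L).IsMinWeight (syn (L + 1)) (cycles (L + 1)) hammingNorm) :
    HasThreshold (fun L p => (D L).logicalFailureProb (syn (L + 1)) (boundaries (L + 1))
      (iidLaw (bitLaw (min p.toNNReal 1) (min_le_right _ _)))) (thresholdValue 2.832) :=
  hasThreshold_of_isThresholdLowerBound (toricThreshold_fisherSykes hD)
    ((thresholdValue_le_half _).trans (by norm_num))

/-- `HasThreshold` at the decimal `.0322` for every minimum-weight decoder family — UNCONDITIONAL.
[cite: DennisEtAl2002, §5.3 eq. (p_c_2d)] -/
theorem hasThreshold_toric_0322 {D : (L : ℕ) → ZDecoder (L + 1)}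
    (hD : ∀ L, (D L).IsMinWeight (syn (L + 1)) (cycles (L + 1)) hammingNorm) :
    HasThreshold (fun L p => (D L).logicalFailureProb (syn (L + 1)) (boundaries (L + 1))
      (iidLaw (bitLaw (min p.toNNReal 1) (min_le_right _ _)))) 0.0322 :=
  hasThreshold_of_isThresholdLowerBound (toricThreshold_0322 hD) (by norm_num)

/-- **Exponential decay below `p₀(2.832)`, UNCONDITIONAL, kernel**: for every minimum-weight decoder
family and every `0 ≤ p < p₀(2.832)` the failure probability decays exponentially in `L` (a walk-count
constant `C` with `cₙ ≤ C·2.832ⁿ` exists since `μ(ℤ²) < 2.832` strictly,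
`exists_sawCountBound_of_connectiveConstant_lt`). [cite: DennisEtAl2002, §5.3 eq. (fail_2d)] -/
theorem toric_decaysExponentially_fisherSykes {D : (L : ℕ) → ZDecoder (L + 1)}
    (hD : ∀ L, (D L).IsMinWeight (syn (L + 1)) (cycles (L + 1)) hammingNorm) {p : ℝ}
    (hp₀ : 0 ≤ p) (hpp : p < thresholdValue 2.832) :
    DecaysExponentially (toricFailureFamily D) p := by
  obtain ⟨C, hC⟩ := exists_sawCountBound_of_connectiveConstant_lt connectiveConstant_two_lt_2832
  exact toric_decaysExponentially_sawCountBound (by norm_num) hC hD hp₀ hpp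

/-- Exponential decay at every `0 ≤ p ≤ .0322`, UNCONDITIONAL, kernel, for every minimum-weight
decoder family. [cite: DennisEtAl2002, §5.3 eq. (fail_2d)] -/
theorem toric_decaysExponentially_0322 {D : (L : ℕ) → ZDecoder (L + 1)}
    (hD : ∀ L, (D L).IsMinWeight (syn (L + 1)) (cycles (L + 1)) hammingNorm) {p : ℝ}
    (hp₀ : 0 ≤ p) (hpp : p ≤ 0.0322) :
    DecaysExponentially (toricFailureFamily D) p :=
  toric_decaysExponentially_fisherSykes hD hp₀ (lt_of_le_of_lt hpp thresholdValue_2832_bounds.1)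

/-- The canonical minimum-weight decoders: exponential decay at every `0 ≤ p ≤ .0322` —
UNCONDITIONAL, kernel. [cite: DennisEtAl2002, §5.3 eq. (fail_2d)] -/
theorem ToricCode.decaysExponentially_minWeight_0322 {p : ℝ} (hp₀ : 0 ≤ p) (hpp : p ≤ 0.0322) :
    DecaysExponentially (toricFailureFamily fun L => Decoder.minWeight (syn (L + 1)) hammingNorm) p :=
  toric_decaysExponentially_0322 (fun L => ToricCode.isMinWeight_minWeight (L + 1)) hp₀ hpp

/-! ### Noisy syndrome measurement (`q = p`): the same value as `phenomThreshold_memFour` -/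

/-- **Phenomenological toric threshold `≥ p₀(4.865)` from the connective-constant form**
`μ(ℤ³) ≤ 4.865` — UNCONDITIONAL, tier CERTIFIED (kernel); the same value as
`phenomThreshold_memFour` (obtained there from the memory-4 COUNT bound), recorded as a consistency
check of the two packagings. [cite: DennisEtAl2002, §5.3 eqs. (saw_3), (threshold_iso_num)] -/
theorem phenomThreshold_fisherSykes_three {T : ℕ → ℕ} (hT : IsPolyBounded T)
    {D : (L : ℕ) → STDecoder (L + 1) (T L)}
    (hD : ∀ L, (D L).IsMinWeight (stSyn (L + 1) (T L)) (stCycles (L + 1) (T L)) hammingNorm) :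
    IsThresholdLowerBound (phenomFailureFamily T D) (thresholdValue 4.865) :=
  phenomThreshold_connectiveConstant_three_le (by norm_num) connectiveConstant_three_le_4865 hT hD

/-! ### The loss (erasure) channel: `y_c > .3531` (kernel, unconditional) -/

/-- **Loss threshold of the toric code `≥ 1/2.832`** — UNCONDITIONAL, tier CERTIFIED (kernel): the
tree's `lossThreshold_inv_connectiveConstant` (`y_c ≥ 1/μ(ℤ²)`, qec-lit-2) with `μ(ℤ²) ≤ 2.832`
(exact memory-4 constant; the previous kernel value was `26^{-1/3} ≈ .3375`).
[cite: DumerKovalevPryadko2015, p. 5 (toric erasure threshold)] -/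
theorem lossThreshold_fisherSykes : IsThresholdLowerBound erasureFamily (1 / 2.832) := by
  refine lossThreshold_inv_connectiveConstant.anti ?_
  have h0 : 0 < SAW.Zd.connectiveConstant 2 := lt_of_lt_of_le one_pos (SAW.Zd.one_le_connectiveConstant 2)
  exact one_div_le_one_div_of_le h0 connectiveConstant_two_le_2832

/-- Decimal certificate: `.3531 < 1/2.832`. [cite: DumerKovalevPryadko2015, p. 5] -/
theorem one_div_2832_gt : (0.3531 : ℝ) < 1 / 2.832 := by norm_num

/-- **`y_c > .3531`** for the toric code under the loss channel (maximum-likelihood / any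
consistent loss decoding via the family `erasureFamily`) — UNCONDITIONAL, tier CERTIFIED (kernel).
[cite: DumerKovalevPryadko2015, p. 5] -/
theorem loss_accuracyThreshold_gt_0353 : (0.3531 : ℝ) < accuracyThreshold erasureFamily :=
  lt_of_lt_of_le one_div_2832_gt
    (le_accuracyThreshold lossThreshold_fisherSykes (by norm_num))

/-- For EVERY family of consistent loss decoders of the toric codes: loss threshold `≥ 1/2.832`
— UNCONDITIONAL, tier CERTIFIED (kernel) (a walk-count constant at `ν = 2.832` exists since
`μ(ℤ²) < 2.832`). [cite: DumerKovalevPryadko2015, p. 5] -/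
theorem lossDecoderThreshold_fisherSykes (D : (L : ℕ) → ErasureDecoder (Edge (L + 1)) (Syndrome (L + 1)))
    (hD : ∀ L, (D L).IsConsistent (syn (L + 1)) (cycles (L + 1))) :
    IsThresholdLowerBound (fun L y => (D L).failureProb (syn (L + 1)) (boundaries (L + 1)) y)
      (1 / 2.832) := by
  obtain ⟨C, hC⟩ := exists_sawCountBound_of_connectiveConstant_lt connectiveConstant_two_lt_2832
  exact erasureDecoderThreshold_of_sawCountBound (by norm_num) hC D hD

end Summit.Ventures.QEC.Thresholds

end
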